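import Mathlib
import Literature.NumberTheory.LFunctions.Zhang2022.Section11AFEWindowMove
import HarnessLib

/-!
# Zhang (2022) §11, proof of Lemma 11.2 for `χψ` on the WIDENED height range `|t − 2πt₀| < 𝓛₁ + 2`
# — the contour move (6.5) with explicit constants (`windowMove11_core_wide`)

Topic `Literature/NumberTheory/LFunctions/Zhang2022` (Landau–Siegel audit tree; verdict-neutral).
Y. Zhang, *Discrete mean estimates and the Landau–Siegel zero*, arXiv:2211.02515v1 (2022)
[Zhang2022LandauSiegel] — **an unrefereed manuscript under adjudication** (campaign D-0069 /
ZHANG-L discharge lane, WP12 helper H2-B; nothing here bears on Theorems 1–2 or on Landau–Siegel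
zeros). Companion of `Section11AFEWindowBounds` / `Section11AFEWindowMove` (sub-step (f)
`WindowMove11` of `Z22:§11.u024`, the §6 step (6.5) for `χψ`).

WHY. §12 p. 67 (tex L3426–3429, `Z22:§12.u009`) applies "the proof of Lemma 11.2 with `s + β₆` in
place of `s`"; `s + β₆` leaves the typed range `InRange112` (`|t − 2πt₀| < 𝓛₁`) by up to `3α/2`. The
§11 proof uses the height only through `4𝓛⁵¹⁹ ≤ t − 𝓛²⁰` and `t ≤ 8𝓛⁵¹⁹`, both true on
`|t − 2πt₀| < 𝓛₁ + 2`; this file re-runs (f) VERBATIM with `InRange112 D s` replaced by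
`InRange61 D s ∧ σ = 1/2` (twins, suffix `_wide`). Theorem-only; 0 new definitions, 0 new facts.

* `windowMove11_core_wide` — twin of `windowMove11_core` (explicit constants); the node-level
  twin `windowMove11_wide` is in the companion `Section11AFEWideWindow`.

## References

* Y. Zhang, arXiv:2211.02515v1 (2022), §6 proof of Lemma 6.1, (6.5) p. 32; §11 Lemma 11.2 p. 65;
  §12 p. 67. [cite: Zhang2022LandauSiegel, §6 (6.5); §11 Lemma 11.2; §12 p.67]
-/

noncomputable section

open Complex Real ComplexConjugate MeasureTheory Set Filter Topology

namespace Literature.NumberTheory.LFunctions.Zhang2022.Section11AFE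

open Skeleton GaussWeight Section6Statements

section BlockFWide

variable {D : ℕ} [NeZero D] (χ : DirichletCharacter ℂ D) (x : Chr D)

/-! ## §1. The contour move with explicit constants, widened range -/

/-- **(f), the contour move with explicit constants, widened range** (twin of `windowMove11_core`):
for `D ≥ 3`, `𝓛 ≥ 2`, `ψ ∈ Ψ`, `σ = 1/2`, `|t − 2πt₀| < 𝓛₁ + 2`, `z ≥ 1/2`, with `X = P^z`, `N = P₁`,
`V = 𝓛²⁰`, `b = 1/(4𝓛³⁰)`, `k = Dp`:
`|(1/2πi)∫_{(−1)} F − (1/2πi)∫_{0−iV}^{0+iV} F| ≤ K₀e^{−bV²/2}M + 2K₁e^{b}e^{−bV²}`.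
[cite: Zhang2022LandauSiegel, §6 (6.5) p. 32; §11 p. 65] -/
theorem windowMove11_core_wide {G : ℝ} (hG0 : 0 ≤ G)
    (hG : ∀ (k : ℕ) [NeZero k] (θ : DirichletCharacter ℂ k) (z : ℂ), -((1 : ℕ) : ℝ) ≤ z.re → z.re ≤ 0 →
      ‖GammaFactor.Zfac θ z‖ ≤ G * (k : ℝ) ^ (1 + 1) * (|z.im| + (1 : ℕ) + 1) ^ (1 + 1))
    (hD : 3 ≤ D) (hp : χ.IsPrimitive) (hL : 2 ≤ ell D) {s : ℂ} (hr61 : InRange61 D s)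
    (hre : s.re = 1 / 2) {z : ℝ} (hz1 : 0.5 ≤ z) :
    ‖vline (integrandDiff χ x (bigP D ^ z) (Skeleton.P1 D) s) (-1) -
        vseg (integrandDiff χ x (bigP D ^ z) (Skeleton.P1 D) s) 0 (ell D ^ 20)‖ ≤
      ((G * ((D * x.p : ℕ) : ℝ) ^ 2 + bigR D) * ⌈Skeleton.P1 D⌉₊ *
          ((bigP D ^ z)⁻¹ * Real.exp (1 / (4 * ell D ^ 30)))) *
        (Real.exp (-(1 / (4 * ell D ^ 30) / 2) * (ell D ^ 20) ^ 2) *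
          (4 / (1 / (4 * ell D ^ 30)) * Real.sqrt (π / (1 / (4 * ell D ^ 30) / 4)) +
            2 * (|s.im| + 2) ^ 2 * Real.sqrt (π / (1 / (4 * ell D ^ 30) / 2)))) +
      2 * ((4 * ((D * x.p : ℕ) : ℝ) ^ 2 * (|s.im| + |ell D ^ 20|) ^ 2 + bigR D) * ⌈Skeleton.P1 D⌉₊ *
        Real.exp (1 / (4 * ell D ^ 30)) * Real.exp (-(1 / (4 * ell D ^ 30)) * (ell D ^ 20) ^ 2)) := by
  obtain ⟨_, him⟩ := hr61
  have hD2 : 2 ≤ D := le_trans (by norm_num) hD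
  have hℓ1 : 1 ≤ ell D := by linarith
  have hℓ0 : 0 < ell D := by linarith
  set L : ℝ := ell D with hLdef
  set V : ℝ := L ^ 20 with hVdef
  set b : ℝ := 1 / (4 * L ^ 30) with hbdef
  set X : ℝ := bigP D ^ z with hXdef
  set N : ℝ := Skeleton.P1 D with hNdef
  set t : ℝ := s.im with htdef
  have hb0 : 0 < b := by rw [hbdef]; positivity
  have hP : 0 < bigP D := Real.exp_pos _
  have hP1 : 1 ≤ bigP D := by
    rw [bigP]; exact Real.one_le_exp (by positivity)
  have hX : 0 < X := Real.rpow_pos_of_pos hP z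
  have hX1 : 1 ≤ X := Real.one_le_rpow hP1 (by linarith)
  have hV1 : 1 ≤ V := one_le_pow₀ hℓ1
  have hV0 : 0 < V := by linarith
  have ht0def : t0 D = L ^ 519 := rfl
  have hR1 : 1 ≤ bigR D := by
    rw [bigR, ht0def]
    have hD1 : (1 : ℝ) ≤ D := by exact_mod_cast le_trans (by norm_num) hD
    have h519 : (1 : ℝ) ≤ L ^ 519 := one_le_pow₀ hℓ1
    calc (1 : ℝ) = 1 * 1 * 1 := by ring
      _ ≤ (D : ℝ) * bigP D * L ^ 519 := by gcongr
  have hR : 0 < bigR D := by linarith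
  -- the height `t`: `t − V ≥ 152`
  have h405 : L ^ 405 ≤ L ^ 519 := pow_le_pow_right₀ hℓ1 (by norm_num)
  have h20 : L ^ 20 ≤ L ^ 519 := pow_le_pow_right₀ hℓ1 (by norm_num)
  have h519 : (152 : ℝ) ≤ L ^ 519 := by
    calc (152 : ℝ) ≤ 2 ^ 8 := by norm_num
      _ ≤ L ^ 8 := pow_le_pow_left₀ (by norm_num) hL 8
      _ ≤ L ^ 519 := pow_le_pow_right₀ hℓ1 (by norm_num)
  have htlow : 4 * L ^ 519 ≤ t - V := by
    have h1 := (abs_lt.mp him).1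
    rw [ell1, ht0def, ← hLdef] at h1
    rw [hVdef, htdef]
    have hpi : 6.28 * L ^ 519 ≤ 2 * π * L ^ 519 :=
      mul_le_mul_of_nonneg_right (by linarith [Real.pi_gt_d2]) (by positivity)
    linarith [h405, h20, h519]
  have htV : V < t := by linarith
  have htpos : 0 < t := by linarith
  have htmV : 152 ≤ |t + -V| := by
    rw [abs_of_pos (by linarith)]; linarith
  have htpV : 152 ≤ |t + V| := by
    rw [abs_of_pos (by linarith)]; linarith
  have hZ : ‖Zpc χ x s‖ = 1 := norm_Zpc_eq_one χ (psiChiPrimitive_holds D χ x hD hp) hre htpos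
  -- the integrand on the line and its integrability
  set Fd : ℂ → ℂ := integrandDiff χ x X N s with hFd
  have hiD : Integrable fun v : ℝ => Fd (((-1 : ℝ) : ℂ) + (v : ℂ) * I) := by
    have e2 : (fun v : ℝ => Fd (((-1 : ℝ) : ℂ) + (v : ℂ) * I)) = fun v : ℝ =>
        integrandHead χ x X N s (((-1 : ℝ) : ℂ) + (v : ℂ) * I) -
          integrandMain χ x X N s (((-1 : ℝ) : ℂ) + (v : ℂ) * I) := by
      funext v; simp only [hFd, integrandHead, integrandMain, integrandDiff]; ring
    rw [e2]
    exact (integrable_integrandHead χ x hD2 hre hX N).sub (integrable_integrandMain χ x hD2 hre hX hR N)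
  -- split the line at `|v| = V`
  set S : Set ℝ := Set.Ioc (-V) V with hSdef
  have hSm : MeasurableSet S := measurableSet_Ioc
  have hsplit := integral_add_compl hSm hiD
  have hIoc : ∫ v in S, Fd (((-1 : ℝ) : ℂ) + (v : ℂ) * I) =
      ∫ v in (-V)..V, Fd (((-1 : ℝ) : ℂ) + (v : ℂ) * I) := by
    rw [intervalIntegral.integral_of_le (by linarith)]
  -- the rectangle
  have hrect := rect_diffReg χ x hV0 htV hX hR N
  have eLeft : ∫ y in (-V)..V, diffReg χ x X N s ((-1 : ℝ) + y * I) =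
      ∫ y in (-V)..V, Fd (((-1 : ℝ) : ℂ) + (y : ℂ) * I) := by
    refine intervalIntegral.integral_congr fun y _ => ?_
    exact diffReg_eq_integrandDiff χ x X N s (by
      intro h; have := congrArg Complex.re h; simp at this)
  have eMid : ∫ y in (-V)..V, diffReg χ x X N s ((0 : ℝ) + y * I) =
      ∫ y in (-V)..V, Fd (((0 : ℝ) : ℂ) + (y : ℂ) * I) := by
    refine intervalIntegral.integral_congr_ae ?_
    have h0 : ∀ᵐ y : ℝ ∂volume, y ≠ 0 := by
      have : ({0}ᶜ : Set ℝ) ∈ ae volume := compl_mem_ae_iff.mpr (measure_singleton _)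
      filter_upwards [this] with v hv using hv
    filter_upwards [h0] with y hy _
    exact diffReg_eq_integrandDiff χ x X N s (by
      intro h; have := congrArg Complex.im h; simp at this; exact hy this)
  -- the horizontal segments
  have hhor : ∀ y : ℝ, |y| = V → 152 ≤ |t + y| →
      ‖∫ u in (-1 : ℝ)..0, diffReg χ x X N s (u + (y : ℝ) * I)‖ ≤
        (4 * ((D * x.p : ℕ) : ℝ) ^ 2 * (|t| + V) ^ 2 + bigR D) * ⌈N⌉₊ * Real.exp b *
          Real.exp (-b * V ^ 2) := by
    intro y hyV hty
    have hy1 : 1 ≤ |y| := by rw [hyV]; exact hV1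
    have hy0 : y ≠ 0 := by intro h; rw [h, abs_zero] at hy1; linarith
    have hbd : ∀ u ∈ Set.uIoc (-1 : ℝ) 0, ‖diffReg χ x X N s (u + (y : ℝ) * I)‖ ≤
        (4 * ((D * x.p : ℕ) : ℝ) ^ 2 * (|t| + V) ^ 2 + bigR D) * ⌈N⌉₊ * Real.exp b *
          Real.exp (-b * V ^ 2) := by
      intro u hu
      rw [Set.uIoc_of_le (by norm_num), Set.mem_Ioc] at hu
      rw [diffReg_eq_integrandDiff χ x X N s (by
        intro h; have := congrArg Complex.im h; simp at this; exact hy0 this)]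
      have h := norm_integrandDiff_horiz_le χ x hD2 hre hZ.le hX1 hR1 N hu.1.le hu.2 hy1 hty
      rw [hyV, show y ^ 2 = V ^ 2 by rw [← sq_abs y, hyV]] at h
      exact h
    have := intervalIntegral.norm_integral_le_of_norm_le_const hbd
    simpa using this
  have hBot := hhor (-V) (by rw [abs_neg, abs_of_pos hV0]) htmV
  have hTop := hhor V (abs_of_pos hV0) htpV
  -- the tails `|v| > V`
  set A : ℝ := |t| + 2 with hAdef
  set K₀ : ℝ := (G * ((D * x.p : ℕ) : ℝ) ^ 2 + bigR D) * ⌈N⌉₊ * (X⁻¹ * Real.exp b) with hK₀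
  set q : ℝ → ℝ := fun v => (|v| + A) ^ 2 * Real.exp (-b * v ^ 2) with hq
  have hpt : ∀ v : ℝ, ‖Fd (((-1 : ℝ) : ℂ) + (v : ℂ) * I)‖ ≤ K₀ * q v := by
    intro v
    have h := norm_integrandDiff_neg_one_le χ x hG hre hZ.le hX hR N v
    rw [hK₀, hq]; exact h
  have hK₀0 : 0 ≤ K₀ := by rw [hK₀]; positivity
  have hqi : Integrable q := integrable_absAddSq_mul_gauss hb0 A
  have hTail : ‖∫ v in Sᶜ, Fd (((-1 : ℝ) : ℂ) + (v : ℂ) * I)‖ ≤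
      K₀ * (Real.exp (-(b / 2) * V ^ 2) *
        (4 / b * Real.sqrt (π / (b / 4)) + 2 * A ^ 2 * Real.sqrt (π / (b / 2)))) := by
    calc ‖∫ v in Sᶜ, Fd (((-1 : ℝ) : ℂ) + (v : ℂ) * I)‖
        ≤ ∫ v in Sᶜ, ‖Fd (((-1 : ℝ) : ℂ) + (v : ℂ) * I)‖ := norm_integral_le_integral_norm _
      _ ≤ ∫ v in Sᶜ, K₀ * q v :=
          setIntegral_mono_on hiD.norm.integrableOn (hqi.const_mul K₀).integrableOn hSm.compl
            (fun v _ => hpt v)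
      _ = K₀ * ∫ v in Sᶜ, q v := integral_const_mul _ _
      _ ≤ K₀ * (Real.exp (-(b / 2) * V ^ 2) *
            (4 / b * Real.sqrt (π / (b / 4)) + 2 * A ^ 2 * Real.sqrt (π / (b / 2)))) :=
          mul_le_mul_of_nonneg_left (gauss_tail_quad_le hb0 A hV0.le) hK₀0
  -- assemble
  have hvl : vline Fd (-1) - vseg Fd 0 V = (1 / (2 * π) : ℂ) *
      ((∫ v in Sᶜ, Fd (((-1 : ℝ) : ℂ) + (v : ℂ) * I)) +
        -I * ((∫ u in (-1 : ℝ)..0, diffReg χ x X N s (u + (-V : ℝ) * I)) -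
          ∫ u in (-1 : ℝ)..0, diffReg χ x X N s (u + (V : ℝ) * I))) := by
    rw [vline, vseg, ← hsplit, hIoc, ← hrect, eLeft, eMid]
    push_cast
    ring
  have h2π : ‖(1 / (2 * π) : ℂ)‖ ≤ 1 := by
    have : (1 / (2 * π) : ℂ) = ((1 / (2 * π) : ℝ) : ℂ) := by push_cast; ring
    rw [this, Complex.norm_real, Real.norm_eq_abs, abs_of_pos (by positivity)]
    rw [div_le_one (by positivity)]; linarith [Real.pi_gt_three]
  rw [hvl, norm_mul]
  have habs : |L ^ 20| = V := abs_of_pos hV0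
  rw [habs]
  calc ‖(1 / (2 * π) : ℂ)‖ * ‖(∫ v in Sᶜ, Fd (((-1 : ℝ) : ℂ) + (v : ℂ) * I)) +
          -I * ((∫ u in (-1 : ℝ)..0, diffReg χ x X N s (u + (-V : ℝ) * I)) -
            ∫ u in (-1 : ℝ)..0, diffReg χ x X N s (u + (V : ℝ) * I))‖
      ≤ 1 * (‖∫ v in Sᶜ, Fd (((-1 : ℝ) : ℂ) + (v : ℂ) * I)‖ +
          (‖∫ u in (-1 : ℝ)..0, diffReg χ x X N s (u + (-V : ℝ) * I)‖ +
            ‖∫ u in (-1 : ℝ)..0, diffReg χ x X N s (u + (V : ℝ) * I)‖)) := by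
        gcongr
        refine (norm_add_le _ _).trans ?_
        gcongr
        rw [norm_mul, norm_neg, Complex.norm_I, one_mul]
        exact norm_sub_le _ _
    _ ≤ K₀ * (Real.exp (-(b / 2) * V ^ 2) *
            (4 / b * Real.sqrt (π / (b / 4)) + 2 * A ^ 2 * Real.sqrt (π / (b / 2)))) +
          2 * ((4 * ((D * x.p : ℕ) : ℝ) ^ 2 * (|t| + V) ^ 2 + bigR D) * ⌈N⌉₊ * Real.exp b *
            Real.exp (-b * V ^ 2)) := by
        rw [one_mul]; linarith [hTail, hBot, hTop]

end BlockFWide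

end Literature.NumberTheory.LFunctions.Zhang2022.Section11AFE
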